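import Summits.CriticalPhenomena.SAWScalingLimit.Theorems.SAWLeftRightFKGFKGToTraversalBoundWitnessBlockMonotone
import Summits.CriticalPhenomena.SAWScalingLimit.Theorems.SAWLeftRightFKGFKGToTraversalBoundWindowBlockShadow
import HarnessLib

/-!
# Witness glue T6a: windows whose contacts stay on one far piece are few (line `slit-necklace`)

Crux `SAWLeftRightFKG.FKGToTraversalBound` (stmt-CriticalPhenomena-1878), line `slit-necklace`, lead
prover-line-stmt-CriticalPhenomena-1878-c5-0; witness glue unit T6a (accounting, pure far-piece windows) of the
planar-witness skeleton `stub_necklaceWitnessFarU`: the registered stub `acc_pureFar_bound`.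

Setting (`FarTipCfg`, …WitnessCfg.lean): the free component `F` of the far tip `t₀` with its wall-follower tour
`btour F e₀` of period `N` without repeats, an outline arc walk `p` inside `F` whose `k`-th vertex is within
sup-distance `1` of the CONTACT `c k = bcontact (btour F e₀ (φ k))`, for monotone positions `φ k ∈ [m, n]`, and a
NON-DEGENERATE far piece `(i'', cfg.pend i'')` other than the piece of the configuration.  Suppose `p` carries `q`
strictly separated index windows `[a mm, b mm]` across a shell `D(y; σ₁, σ₂)` of width `> 4δ` all of whose contacts
are interior vertices of that piece, while the piece itself has NOT got `W + 1` separated windows across the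
shrunken shell `D(y; σ₁ + 2δ, σ₂ - 2δ)` (the rank hypothesis).  Claim: `q ≤ 4 W + 4`.

Proof: `witness_blockMonotone` makes the chord index of the contacts block-monotone off one cut `kcut`; choosing
for every window vertex the chord index `cidx k` of its contact (`i'' < cidx k < pend i''`,
`γ (cidx k) = c k`, at Euclidean distance `≤ 2δ` from the vertex since each lattice coordinate differs by `≤ 1`),
`hasSepWindows_of_blockMonotone_shadow` transfers the `q` windows of `p` to `(q - 1) / 4` separated windows of `γ`
inside `[i'' + 1, pend i'' - 1]` across the shrunken shell; if `q ≥ 4 W + 5` these are `≥ W + 1` windows,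
contradicting the rank hypothesis.

All statements folklore; no literature fact; nothing restates the crux.
-/

noncomputable section

open Filter Topology Set Metric
open Literature.Probability.LatticeModels
open Literature.Probability.RandomPlanarGeometry
open Literature.Probability.RandomPlanarGeometry.SAW
open Summit.CriticalPhenomena.SAWScalingLimit.Theorems.FKGToTraversalBound.Negative (dom)

namespace Summit.CriticalPhenomena.SAWScalingLimit.Theorems.FKGToTraversalBound.SlitNecklace

/-- **Sup-close sites have `2δ`-close mesh points.**  If every lattice coordinate of `x - x'` has absolute value
`≤ 1`, then `dist (meshPoint δ x) (meshPoint δ x') ≤ 2δ` (`‖z‖ ≤ |re z| + |im z|`). [folklore] -/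
theorem pf_dist_meshPoint_le {δ : ℝ} (hδ : 0 ≤ δ) {x x' : Site 2} (h : ∀ ii : Fin 2, |(x - x') ii| ≤ 1) :
    dist (meshPoint δ x) (meshPoint δ x') ≤ 2 * δ := by
  have h0 : |((x 0 : ℝ) - (x' 0 : ℝ))| ≤ 1 := by
    have := h 0
    rw [Pi.sub_apply] at this
    exact_mod_cast this
  have h1 : |((x 1 : ℝ) - (x' 1 : ℝ))| ≤ 1 := by
    have := h 1
    rw [Pi.sub_apply] at this
    exact_mod_cast this
  rw [Complex.dist_eq]
  refine (Complex.norm_le_abs_re_add_abs_im _).trans ?_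
  simp only [Complex.sub_re, Complex.sub_im, meshPoint_re, meshPoint_im]
  rw [← mul_sub, ← mul_sub, abs_mul, abs_mul, abs_of_nonneg hδ]
  have e0 := mul_le_mul_of_nonneg_left h0 hδ
  have e1 := mul_le_mul_of_nonneg_left h1 hδ
  linarith

/-- **Witness glue T6a (registered stub `acc_pureFar_bound`).**  In a far-tip configuration, along an outline arc
walk `p` of the free component `F` shadowing the tour arc `[m, n]` (vertex `k` sup-close to its contact
`bcontact (btour F e₀ (φ k))`), at most `4 W + 4` strictly separated index windows of `p` across a shell
`D(y; σ₁, σ₂)` of width `> 4δ` have ALL their contacts interior to one non-degenerate far piece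
`(i'', pend i'')` other than the piece of the configuration, provided that piece has not got `W + 1` separated
windows across `D(y; σ₁ + 2δ, σ₂ - 2δ)`: block-monotonicity of the contact index (`witness_blockMonotone`) and the
window shadow lemma `hasSepWindows_of_blockMonotone_shadow`. [folklore] -/
theorem acc_pureFar_bound : ∀ {D : DobrushinDomain} (cfg : FarTipCfg D) (F B : Finset (Site 2)) (e₀ : Site 2 × ODir) (n₁ N m n : ℕ) (p : (zdGraph 2).Walk (bsite (btour (↑F : Set (Site 2)) e₀ m)) (bsite (btour (↑F : Set (Site 2)) e₀ n))) (φ : ℕ → ℕ) (y : ℂ) (σ₁ σ₂ : ℝ) (W i'' q : ℕ) (a b : Fin q → ℕ), (∀ x, x ∈ F ↔ x ∈ cfg.Fset) → (∀ x, x ∈ B ↔ x ∈ cfg.Bset) → (∀ x ∈ B, x ∈ cfg.Λ) → 2 ≤ F.card → (∀ x ∈ F, x ∉ cfg.K) → (∀ x ∈ F, ∀ y ∈ F, ∃ w : (zdGraph 2).Walk x y, ∀ z ∈ w.support, z ∈ F) → (∀ x ∈ F, ∀ y : Site 2, y ∉ F → (zdGraph 2).Adj x y → y ∈ cfg.K ∨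 y ∈ cfg.C.support) → (∀ x ∈ F, ∀ y ∈ F, (zdGraph 2).Adj x y → cfg.G.Adj x y) → (∀ x ∈ B, ∀ y ∈ B, (zdGraph 2).Adj x y → cfg.G.Adj x y) → (∀ k ∈ cfg.K, ∃ (q : Site 2) (w : (zdGraph 2).Walk k q), q ∈ cfg.C.support ∧ ∀ z ∈ w.support, z ∈ cfg.K ∨ z ∈ cfg.C.support) → IsBEdge (↑F : Set (Site 2)) e₀ → bsite e₀ = cfg.t₀ → bcontact e₀ = cfg.γ.getVert (cfg.τ - 1) → 0 < n₁ → n₁ < N → btour (↑F : Set (Site 2)) e₀ N = e₀ → (∀ j j', j < N → j' < N → btour (↑F : Set (Site 2)) e₀ j = btour (↑F : Set (Site 2)) e₀ j' → j = j') → ((m = 0 ∧ n = n₁) ∨ (m = n₁ ∧ n = N)) → (∀ z ∈ p.support, z ∈ F) → Monotone φ → (∀ k, k ≤ p.length → m ≤ φ k ∧ φ k ≤ n ∧ ∀ ii : Fin 2, |(p.getVert k - bcontact (btour (↑F : Set (Site 2)) e₀ (φ k))) ii| ≤ 1) → i'' ∈ cfg.farStarts → cfg.NonDeg i'' → i'' ≠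 cfg.i → σ₁ < σ₂ → 4 * cfg.δ < σ₂ - σ₁ → ¬ HasSepWindows (meshPoint cfg.δ) cfg.γ (W + 1) (i'' + 1) (cfg.pend i'' - 1) y (σ₁ + 2 * cfg.δ) (σ₂ - 2 * cfg.δ) → (∀ mm, a mm ≤ b mm ∧ b mm ≤ p.length) → (∀ ⦃mm mm' : Fin q⦄, mm < mm' → b mm < a mm') → (∀ mm, (dist (meshPoint cfg.δ (p.getVert (a mm))) y ≤ σ₁ ∧ σ₂ ≤ dist (meshPoint cfg.δ (p.getVert (b mm))) y) ∨ (σ₂ ≤ dist (meshPoint cfg.δ (p.getVert (a mm))) y ∧ dist (meshPoint cfg.δ (p.getVert (b mm))) y ≤ σ₁)) → (∀ (mm : Fin q) (k : ℕ), a mm ≤ k → k ≤ b mm → bcontact (btour (↑F : Set (Site 2)) e₀ (φ k)) ∈ cfg.V i'' (cfg.pend i'')) → q ≤ 4 * W + 4 := by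
  intro D cfg F B e₀ n₁ N m n p φ y σ₁ σ₂ W i'' q a b hF hB hBΛ hF2 hFK hFconn hFbd hFG hBG hKatt he₀ hbs hbc
    hn₁ hn₁N hN hinj hmn hpF hφ hφb hi'' hnd hne _ h4δ hrank hab hsep hside hpure
  -- (1) the chord index of the contacts interior to the piece is block-monotone off one cut
  obtain ⟨kcut, hmono⟩ := witness_blockMonotone cfg F B e₀ n₁ N m n p φ i'' hF hB hBΛ hF2 hFK hFconn hFbd
    hFG hBG hKatt he₀ hbs hbc hn₁ hn₁N hN hinj hmn hpF hφ (fun k hk => ⟨(hφb k hk).1, (hφb k hk).2.1⟩)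
    hi'' hnd hne
  -- (2) the shadow index: the chord index of the contact of every window vertex
  have hex : ∀ k : ℕ, ∃ m₁ : ℕ, (∃ mm : Fin q, a mm ≤ k ∧ k ≤ b mm) →
      i'' < m₁ ∧ m₁ < cfg.pend i'' ∧ cfg.γ.getVert m₁ = bcontact (btour (↑F : Set (Site 2)) e₀ (φ k)) := by
    intro k
    by_cases h : ∃ mm : Fin q, a mm ≤ k ∧ k ≤ b mm
    · obtain ⟨mm, h1, h2⟩ := h
      obtain ⟨m₁, hm₁⟩ := (PresCfg.mem_V_iff _).1 (hpure mm k h1 h2)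
      exact ⟨m₁, fun _ => hm₁⟩
    · exact ⟨0, fun h' => absurd h' h⟩
  choose cidx hcidx using hex
  -- (3) transfer the windows of `p` to windows of the piece across the shrunken shell
  have hδ := cfg.hδ
  have hlen : cfg.pend i'' ≤ cfg.γ.length := (rest_isPiece_pend cfg hi'').2.1.1
  have hW : HasSepWindows (meshPoint cfg.δ) cfg.γ ((q - 1) / 4) (i'' + 1) (cfg.pend i'' - 1) y
      (σ₁ + 2 * cfg.δ) (σ₂ - 2 * cfg.δ) := by
    refine hasSepWindows_of_blockMonotone_shadow cfg.δ (meshPoint cfg.δ) p cfg.γ q a b cidx kcut i''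
      (cfg.pend i'') y σ₁ σ₂ (2 * cfg.δ) (by linarith) (by linarith) hlen hab hsep hside ?_ ?_
    · intro mm k h1 h2
      obtain ⟨hi1, hi2, hγ⟩ := hcidx k ⟨mm, h1, h2⟩
      refine ⟨hi1, hi2, ?_⟩
      rw [hγ]
      exact pf_dist_meshPoint_le hδ.le (hφb k (h2.trans (hab mm).2)).2.2
    · refine hmono.imp (fun h mm mm₂ k k₂ h1 h2 h3 h4 h5 h6 => ?_)
        (fun h mm mm₂ k k₂ h1 h2 h3 h4 h5 h6 => ?_)
      · obtain ⟨hi1, hi2, hγ1⟩ := hcidx k ⟨mm, h1, h2⟩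
        obtain ⟨hj1, hj2, hγ2⟩ := hcidx k₂ ⟨mm₂, h3, h4⟩
        exact h k k₂ (cidx k) (cidx k₂) h5 (h4.trans (hab mm₂).2) h6 hi1 hi2 hj1 hj2 hγ1.symm hγ2.symm
      · obtain ⟨hi1, hi2, hγ1⟩ := hcidx k ⟨mm, h1, h2⟩
        obtain ⟨hj1, hj2, hγ2⟩ := hcidx k₂ ⟨mm₂, h3, h4⟩
        exact h k k₂ (cidx k) (cidx k₂) h5 (h4.trans (hab mm₂).2) h6 hi1 hi2 hj1 hj2 hγ1.symm hγ2.symm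
  -- (4) too many windows would give `W + 1` windows of the piece, against the rank hypothesis
  by_contra hq
  exact hrank (hW.of_le (by omega))

end Summit.CriticalPhenomena.SAWScalingLimit.Theorems.FKGToTraversalBound.SlitNecklace

end
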